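import Literature.AlgebraicGeometry.Resolution.InseparableLocalUniformizationCurves
import Literature.AlgebraicGeometry.Resolution.KnafKuhlmann2009Thm11
import HarnessLib

/-!
# Smooth-equivalence from two charts realized in one valued field

Topic: `Literature/AlgebraicGeometry/Resolution` (valued function fields; models over valuation
rings). Groundwork for the algebraization step of M. Temkin, *Inseparable local uniformization*,
J. Algebra 373 (2013) = arXiv:0804.1554v3, Thm. 3.3.1 (tree: the named fact
`Temkin2013RelativeCurveSmoothFibre`, whose conclusion is an `AreSmoothEquivalent`, Temkin's
Definition 2.8.1: a common smooth roof `X ← Z → Y` through the two points).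

When both points are centres of ONE valuation ring `V` of an ambient field `Ω` on subrings
`A → Ω`, `B → Ω`, a roof is obtained from two CHARTS inside `Ω`: an `A`-subalgebra `T_A ⊆ V`
smooth over `A` and a `B`-subalgebra `T_B ⊆ V` smooth over `B` which become EQUAL after
inverting one `V`-unit on each side (`T_B ⊆ T_A[1/s_A]`, `T_A ⊆ T_B[1/s_B]`). The common
localization `D = T_A[1/s_A][1/s_B] = T_B[1/s_B][1/s_A] ⊆ V` is then smooth over both `A` and
`B` (localization away from an element is smooth), the structure maps agree because everything
is an inclusion of subrings of `Ω`, and `D ∩ 𝔪_V` is a prime over both centres. This is how the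
two explicit étale charts of the algebraic proof of Thm. 3.3.1 (a Hensel chart over the
normalized `K`-rational model and a standard-étale chart over a polynomial ring over `m°`, both
realized inside the henselization) are glued; cf. the end of the printed proof (p. 45: "the
morphism `Y → X′` is étale at `y` … and `Y → Spec(m°)` is smooth at `y`", with `Y` ONE scheme
carrying both structures).

* `locAway_locAway_coe_eq` — `T_A[1/s_A][1/s_B] = T_B[1/s_B][1/s_A]` as subsets of `Ω` under the
  two inclusions — PROVED;
* `AreSmoothEquivalent.of_subalgebra_coe_eq` — smooth-equivalence of the two centres of `V` from
  ONE subset of `V` which is simultaneously a smooth `A`-subalgebra and a smooth `B`-subalgebra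
  — PROVED;
* `AreSmoothEquivalent.of_charts` — the same from two charts and two `V`-units as above — PROVED;
* `mem_maximalIdeal_iff_valuation_lt_one_of_comap_eq`,
  `mem_comap_maximalIdeal_iff_valuation_lt_one_of_comap_eq` — the centres of `V` on a valuation
  subring `V ∩ m` and on a subring of `V ∩ L₁`, in the form consumed by the two theorems —
  PROVED.

All statements are [folklore]; no definitions, no named facts.

## Sources

* M. Temkin, arXiv:0804.1554v3, Definition 2.8.1 and the end of the proof of Thm. 3.3.1 (p. 45).
* The Stacks Project, Tag 00TD-type facts (localization away from an element is smooth; smooth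
  is stable under composition), through Mathlib (`Algebra.Smooth.of_isLocalization_Away`,
  `Algebra.Smooth.comp`, `Algebra.Smooth.of_equiv`) and the tree (`locAway`,
  `smooth_locAway_of_smooth`).
-/

noncomputable section

namespace Literature.AlgebraicGeometry.Resolution

universe u

open IsLocalRing

/-! ### Two localizations away from an element commute (as subsets of the field) -/

section LocAway

variable {Ω : Type*} [Field Ω] {R S : Type*} [CommRing R] [CommRing S] [Algebra R Ω] [Algebra S Ω]

/-- **Mutual localizations coincide.** If `C ⊆ B[1/f]` and `B ⊆ C[1/g]` inside a field, for an
`R`-subalgebra `B ∋ f` and an `S`-subalgebra `C ∋ g`, then `B[1/f][1/g] = C[1/g][1/f]` as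
subsets. [folklore] -/
theorem locAway_locAway_coe_eq {B : Subalgebra R Ω} {C : Subalgebra S Ω} {f g : Ω}
    (hf : f ∈ B) (hg : g ∈ C)
    (hCB : (C : Set Ω) ⊆ locAway B f hf) (hBC : (B : Set Ω) ⊆ locAway C g hg) :
    ((locAway (locAway B f hf) g (hCB hg) : Subalgebra R Ω) : Set Ω) =
      (locAway (locAway C g hg) f (hBC hf) : Subalgebra S Ω) := by
  ext w
  simp only [SetLike.mem_coe, mem_locAway_iff]
  constructor
  · rintro ⟨n, m, h⟩
    obtain ⟨n', h'⟩ := hBC h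
    refine ⟨m, n + n', ?_⟩
    have : w * f ^ m * g ^ (n + n') = w * g ^ n * f ^ m * g ^ n' := by ring
    rw [this]
    exact h'
  · rintro ⟨n, m, h⟩
    obtain ⟨n', h'⟩ := hCB h
    refine ⟨m, n + n', ?_⟩
    have : w * g ^ m * f ^ (n + n') = w * f ^ n * g ^ m * f ^ n' := by ring
    rw [this]
    exact h'

/-- A double localization away from `V`-units stays inside `V`. [folklore] -/
theorem locAway_locAway_le_valuationSubring {B : Subalgebra R Ω} {f g : Ω} {hf : f ∈ B}
    {hg : g ∈ locAway B f hf} {V : ValuationSubring Ω} (hBV : B.toSubring ≤ V.toSubring)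
    (hvf : V.valuation f = 1) (hvg : V.valuation g = 1) :
    (locAway (locAway B f hf) g hg).toSubring ≤ V.toSubring :=
  locAway_le_valuationSubring (locAway_le_valuationSubring hBV hvf) hvg

/-- A double localization away from non-zero elements of a smooth subalgebra is smooth.
[folklore] -/
theorem smooth_locAway_locAway {B : Subalgebra R Ω} {f g : Ω} {hf : f ∈ B}
    {hg : g ∈ locAway B f hf} (hf0 : f ≠ 0) (hg0 : g ≠ 0) [Algebra.Smooth R B] :
    Algebra.Smooth R (locAway (locAway B f hf) g hg) := by
  haveI : Algebra.Smooth R (locAway B f hf) := smooth_locAway_of_smooth hf0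
  exact smooth_locAway_of_smooth hg0

end LocAway

/-! ### The roof -/

section Roof

variable {R₀ A B Ω : Type u} [CommRing R₀] [CommRing A] [CommRing B] [Field Ω]
  [Algebra A Ω] [Algebra B Ω]

/-- **Smooth-equivalence from one subset carrying two smooth structures.** Let `A → Ω ← B` be
rings over `R₀` mapping compatibly into a field `Ω` with a valuation ring `V`, and let `p ⊂ A`,
`q ⊂ B` be the centres of `V`. If some subset of `V` is at the same time a smooth `A`-subalgebra
`T_A` and a smooth `B`-subalgebra `T_B` of `Ω`, then `p` and `q` are smooth-equivalent over
`R₀`: the roof is `Z = Spec T_A` with the point `T_A ∩ 𝔪_V`. [folklore] -/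
theorem AreSmoothEquivalent.of_subalgebra_coe_eq (f : R₀ →+* A) (g : R₀ →+* B)
    (hcomp : (algebraMap A Ω).comp f = (algebraMap B Ω).comp g)
    (V : ValuationSubring Ω) {p : Ideal A} {q : Ideal B}
    (hp : ∀ a, a ∈ p ↔ V.valuation (algebraMap A Ω a) < 1)
    (hq : ∀ b, b ∈ q ↔ V.valuation (algebraMap B Ω b) < 1)
    (TA : Subalgebra A Ω) (TB : Subalgebra B Ω) [Algebra.Smooth A TA] [Algebra.Smooth B TB]
    (hTV : TA.toSubring ≤ V.toSubring) (heq : (TA : Set Ω) = TB) :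
    AreSmoothEquivalent f g p q := by
  -- the `B`-algebra structure of `T_A`, transported from `T_B`
  have hmemB : ∀ b : B, algebraMap B Ω b ∈ TA := fun b => by
    have h : algebraMap B Ω b ∈ (TB : Set Ω) := TB.algebraMap_mem b
    rw [← heq] at h
    exact h
  letI algB : Algebra B TA := ((algebraMap B Ω).codRestrict TA hmemB).toAlgebra
  have hmemTA : ∀ x : TB, (x : Ω) ∈ TA := fun x => by
    have h : (x : Ω) ∈ (TB : Set Ω) := x.2
    rw [← heq] at h
    exact h
  have hmemTB : ∀ x : TA, (x : Ω) ∈ TB := fun x => by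
    have h : (x : Ω) ∈ (TA : Set Ω) := x.2
    rw [heq] at h
    exact h
  let φ : TB →ₐ[B] TA :=
    { toFun := fun x => ⟨x, hmemTA x⟩
      map_one' := Subtype.ext rfl
      map_mul' := fun _ _ => Subtype.ext rfl
      map_zero' := Subtype.ext rfl
      map_add' := fun _ _ => Subtype.ext rfl
      commutes' := fun _ => Subtype.ext rfl }
  have hφbij : Function.Bijective φ := by
    constructor
    · intro x y hxy
      exact Subtype.ext (congrArg (fun z : TA => (z : Ω)) hxy)
    · intro y
      exact ⟨⟨y, hmemTB y⟩, Subtype.ext rfl⟩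
  let e : TB ≃ₐ[B] TA := AlgEquiv.ofBijective φ hφbij
  haveI hsmB : Algebra.Smooth B TA := Algebra.Smooth.of_equiv e
  refine ⟨TA, inferInstance, inferInstance, algB, ?_, inferInstance, hsmB, ?_⟩
  · refine RingHom.ext fun r => Subtype.ext ?_
    exact RingHom.congr_fun hcomp r
  · -- the point: `T_A ∩ 𝔪_V`
    let ρ : TA →+* V := TA.val.toRingHom.codRestrict V fun x => hTV x.2
    refine ⟨(maximalIdeal V).comap ρ, Ideal.comap_isPrime ρ _, ?_, ?_⟩
    · ext a
      rw [Ideal.mem_comap, Ideal.mem_comap, hp a, ValuationSubring.valuation_lt_one_iff]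
      rfl
    · ext b
      rw [Ideal.mem_comap, Ideal.mem_comap, hq b, ValuationSubring.valuation_lt_one_iff]
      rfl

/-- **Smooth-equivalence from two charts realized in one valued field.** In the situation of
`AreSmoothEquivalent.of_subalgebra_coe_eq`, let `T_A ⊆ V` be a smooth `A`-subalgebra and
`T_B` a smooth `B`-subalgebra of `Ω`, and `s_A ∈ T_A`, `s_B ∈ T_B` units of `V` with
`T_B ⊆ T_A[1/s_A]` and `T_A ⊆ T_B[1/s_B]` (so that `T_B ⊆ V` as well). Then the centres `p`, `q` of `V` on `A` and `B`
are smooth-equivalent over `R₀` (roof: the common localization `T_A[1/s_A][1/s_B] =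
T_B[1/s_B][1/s_A] ⊆ V`). [folklore] -/
theorem AreSmoothEquivalent.of_charts (f : R₀ →+* A) (g : R₀ →+* B)
    (hcomp : (algebraMap A Ω).comp f = (algebraMap B Ω).comp g)
    (V : ValuationSubring Ω) {p : Ideal A} {q : Ideal B}
    (hp : ∀ a, a ∈ p ↔ V.valuation (algebraMap A Ω a) < 1)
    (hq : ∀ b, b ∈ q ↔ V.valuation (algebraMap B Ω b) < 1)
    (TA : Subalgebra A Ω) (TB : Subalgebra B Ω) [Algebra.Smooth A TA] [Algebra.Smooth B TB]
    (hTAV : TA.toSubring ≤ V.toSubring)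
    {sA sB : Ω} (hsA : sA ∈ TA) (hsB : sB ∈ TB)
    (hvA : V.valuation sA = 1) (hvB : V.valuation sB = 1)
    (hAB : (TB : Set Ω) ⊆ locAway TA sA hsA) (hBA : (TA : Set Ω) ⊆ locAway TB sB hsB) :
    AreSmoothEquivalent f g p q := by
  have hsA0 : sA ≠ 0 := fun h0 => by
    rw [h0, map_zero] at hvA
    exact zero_ne_one hvA
  have hsB0 : sB ≠ 0 := fun h0 => by
    rw [h0, map_zero] at hvB
    exact zero_ne_one hvB
  haveI : Algebra.Smooth A (locAway (locAway TA sA hsA) sB (hAB hsB)) :=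
    smooth_locAway_locAway hsA0 hsB0
  haveI : Algebra.Smooth B (locAway (locAway TB sB hsB) sA (hBA hsA)) :=
    smooth_locAway_locAway hsB0 hsA0
  exact AreSmoothEquivalent.of_subalgebra_coe_eq f g hcomp V hp hq
    (locAway (locAway TA sA hsA) sB (hAB hsB)) (locAway (locAway TB sB hsB) sA (hBA hsA))
    (locAway_locAway_le_valuationSubring hTAV hvA hvB) (locAway_locAway_coe_eq hsA hsB hAB hBA)

end Roof

/-! ### The centres of `V` in the consumed form -/

section Centres

variable {Ω : Type u} [Field Ω] (V : ValuationSubring Ω)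

/-- If `V` induces `Om` on `m`, the valuation of `Om` is equivalent to `V ∘ (m → Ω)`.
[folklore] -/
theorem isEquiv_valuation_comap_of_comap_eq {m : Type u} [Field m] (φ : m →+* Ω)
    (Om : ValuationSubring m) (hOm : V.comap φ = Om) :
    (V.valuation.comap φ).IsEquiv Om.valuation := by
  rw [Valuation.isEquiv_iff_valuationSubring, ValuationSubring.valuationSubring_valuation]
  ext x
  rw [Valuation.mem_valuationSubring_iff, Valuation.comap_apply,
    ValuationSubring.valuation_le_one_iff, ← hOm, ValuationSubring.mem_comap]

/-- **The centre of `V` on `V ∩ m` is the maximal ideal**: if `V` induces the valuation ring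
`Om` on `m → Ω`, then `b ∈ 𝔪(Om) ↔ |b|_V < 1`. [folklore] -/
theorem mem_maximalIdeal_iff_valuation_lt_one_of_comap_eq {m : Type u} [Field m]
    (φ : m →+* Ω)
    (Om : ValuationSubring m) (hOm : V.comap φ = Om) (b : Om) :
    b ∈ maximalIdeal Om ↔ V.valuation (φ b) < 1 := by
  rw [ValuationSubring.valuation_lt_one_iff,
    ← (isEquiv_valuation_comap_of_comap_eq V φ Om hOm).lt_one_iff_lt_one, Valuation.comap_apply]

/-- **The centre of `V` on a subring of `V ∩ L₁`**: if `V` induces `O₁` on `L₁ → Ω` and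
`N ≤ O₁`, then `a ∈ 𝔪(O₁) ∩ N ↔ |a|_V < 1`. [folklore] -/
theorem mem_comap_maximalIdeal_iff_valuation_lt_one_of_comap_eq {L₁ : Type u} [Field L₁]
    (φ : L₁ →+* Ω)
    (O₁ : ValuationSubring L₁) (hO₁ : V.comap φ = O₁) {N : Subring L₁}
    (hN : N ≤ O₁.toSubring) (a : N) :
    a ∈ (maximalIdeal O₁).comap (Subring.inclusion hN) ↔ V.valuation (φ a) < 1 := by
  rw [Ideal.mem_comap, mem_maximalIdeal_iff_valuation_lt_one_of_comap_eq V φ O₁ hO₁]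
  rfl

end Centres

end Literature.AlgebraicGeometry.Resolution

end
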